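import Literature.Probability.RandomPlanarGeometry.HexSAWStripSurfaceThresholdRate
import Literature.Probability.RandomPlanarGeometry.HexSAWStripSurfaceGrowthLogConvex
import HarnessLib

/-!
# `y_T` is the UNIQUE solution of `ν_T(y) = x_c⁻¹`, and `ν_T(y) ≶ x_c⁻¹ ⟺ y ≶ y_T`
# (BBdGDCG14, Corollary 8: the uniqueness clause and the display (15))

Topic `Literature/Probability/RandomPlanarGeometry` (continues `HexSAWStripSurfaceThresholdRate.lean` — ★ `HV.stripNu_stripYT :
ν_T(y_T) = x_c⁻¹`, `HV.stripNu_one_le_inv`, `HV.one_lt_stripYT`, `HV.stripYT_pos` —, `HexSAWStripSurfaceGrowthLogConvex.lean` — the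
log-convexity of `ν_T` in `log y` and the strictness it propagates, `HV.stripNu_lt_of_lt_right`, `HV.stripNu_lt_of_right_lt`,
`HV.strictMonoOn_stripNu_Ici` — and `HexSAWStripSurfaceGrowthStrict.lean` — `HV.stripNu_lt_succ : ν_T(y) < ν_{T+1}(y)`, `y ≥ 1`;
token `HV.stripNu` of `HexSAWStripSurfaceGrowth.lean`).  Source: N. R. Beaton, M. Bousquet-Mélou, J. de Gier, H. Duminil-Copin, A. J. Guttmann, *The critical
fugacity for surface adsorption of self-avoiding walks on the honeycomb lattice is `1 + √2`*, Comm. Math. Phys. 326 (2014) 727–754,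
arXiv:1109.0358v5, §3.2 Corollary 8 (p. 12): "There exists a unique `y_T > 0` such that `ρ_T(y_T) = x_c := 1/μ`. The series (in `y`)
`A_T(x_c,y)`, `B_T(x_c,y)` and `C_T(x_c,y)` have radius of convergence `y_T`", with `C_T(x,y) := Σ_{n ≥ 0} C_{T,n}(1,y) xⁿ` "counting walks in a
strip that interact with the top boundary" (p. 12), and the proof (p. 13): "The uniqueness of `y_T` follows from the log-convexity of
`µ_T(y)` in `log y`, together with `ρ_T(1) > x_c`: this precludes having `ρ_T(y) = ρ_T(y′) = x_c` with `y ≠ y′`. This also means that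
`ρ_T(y) < ρ_T(y_T) ⟺ y > y_T` and `ρ_T(y) > ρ_T(y_T) ⟺ y < y_T`. (15) …
By definition of `ρ_T`, the series `C_T(x_c,y)` converges if `x_c < ρ_T(y)`, and diverges if
`x_c > ρ_T(y)`. But `x_c = ρ_T(y_T)`, so by (15), this means that `C_T(x_c,y)` converges if `y < y_T` and diverges if `y > y_T`, which
means that `y_T` is the radius of `C_T(x_c,y)`."

## What is proved (namespace `Literature.Probability.RandomPlanarGeometry.SAW.HV`; `T ≥ 1`; standard axioms)

For the lane's threshold `y_T = HV.stripYT T` (the boundedness threshold of the critical `y`-weighted bridge class) and the lane's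
top-weighted translation-class growth rate `ν_T = HV.stripNu T` (`ρ_T = 1/ν_T`):

* `stripNu_one_lt_inv` — `ν_T(1) < x_c⁻¹` (= `ν_T(y_T)`): the one strict pair the convexity argument needs (Proposition 7's strict
  `ν_T(1) < ν_{T+1}(1)` and `ν_{T+1}(1) ≤ x_c⁻¹`);
* ★★ **`stripNu_lt_inv_of_lt_stripYT`** (`0 < y < y_T ⇒ ν_T(y) < x_c⁻¹`), ★★ **`inv_lt_stripNu_of_stripYT_lt`** (`y > y_T ⇒ x_c⁻¹ < ν_T(y)`)
  — the STRICT forms of the tree's `stripNu_le_inv_of_lt_stripYT` / `inv_le_stripNu_of_stripYT_lt`; the printed display (15):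
  **`stripNu_lt_inv_iff`** (`ν_T(y) < x_c⁻¹ ↔ y < y_T`), **`inv_lt_stripNu_iff`** (`x_c⁻¹ < ν_T(y) ↔ y_T < y`), `stripNu_le_inv_iff`,
  `inv_le_stripNu_iff`;
* ★★ **`stripNu_eq_inv_iff`** (`ν_T(y) = x_c⁻¹ ↔ y = y_T`, `y > 0`) and **`existsUnique_stripNu_eq_inv`** — "There exists a UNIQUE `y_T > 0`
  such that `ρ_T(y_T) = x_c`"; `strictMonoOn_stripNu_Ici_stripYT` (`ν_T` strictly increasing on `[y_T, ∞)`).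

(The radius clause "`C_T(x_c,y)` converges iff `y < y_T`" for `Σ_n x_c^{n+1} Z_n(y)` is the lane's «THRESHOLD-DIVERGENCE» file
(`summable_pow_mul_stripZL_iff_lt_stripYT`), by the bridge-decomposition route; it is not restated here.)

Label: CONSOLIDATION — printed statements by the PRINTED mechanism (log-convexity of the growth rate in `log y`), for the lane's objects
`stripYT`/`stripNu`; the identification of the lane's `y_T` with the printed `y_T` is the capstone's READING (`HexSAWSurfaceFugacity.lean`),
not asserted here.  Lane «pcv-sawmu», a-p2 g12, 2026-08-24 (edition 2: docstring tokens of lit-1 g16; edition 3: the `C_T` radius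
section dropped — it is the lane's «THRESHOLD-DIVERGENCE» content; edition 4 (a-p2 g15): the quoted log-convexity clause reads `µ_T(y)` as printed,
per ref g54 / lit-2 g23 token TU-1, docstring-only).
-/

noncomputable section

open Finset Filter Topology

namespace Literature.Probability.RandomPlanarGeometry.SAW.HV

variable {T : ℕ}

/-! ### The strict pair `ν_T(1) < ν_T(y_T) = x_c⁻¹` -/

/-- **`ν_T(1) < x_c⁻¹`**: Proposition 7's strict `ν_T(1) < ν_{T+1}(1)` with `ν_{T+1}(1) ≤ x_c⁻¹` (`1 < y_{T+1}`).
[cite: BeatonBousquetMelouDeGierDuminilCopinGuttmann2014, Proposition 7 (arXiv v5 p. 11: μ_T(1,y) < μ_{T+1}(1,y)) and Corollary 8, proof (p. 12: "ρ_T(1) > x_c")] -/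
theorem stripNu_one_lt_inv (hT : 1 ≤ T) : stripNu T 1 < hexCriticalFugacity⁻¹ :=
  (stripNu_lt_succ hT le_rfl).trans_le (stripNu_one_le_inv (T := T + 1) (by omega))

/-- `ν_T(1) < ν_T(y_T)`. [cite: BeatonBousquetMelouDeGierDuminilCopinGuttmann2014, Corollary 8, proof (arXiv v5 pp. 12–13: ρ_T(1) > x_c = ρ_T(y_T))] -/
theorem stripNu_one_lt_stripNu_stripYT (hT : 1 ≤ T) : stripNu T 1 < stripNu T (stripYT T) := by
  rw [stripNu_stripYT hT]
  exact stripNu_one_lt_inv hT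

/-! ### Corollary 8's display (15): `ν_T(y) < x_c⁻¹ ⟺ y < y_T`, `ν_T(y) > x_c⁻¹ ⟺ y > y_T` -/

/-- ★★ **Below the threshold, STRICTLY: `0 < y < y_T ⇒ ν_T(y) < x_c⁻¹`** ("`ρ_T(y) > ρ_T(y_T) ⟸ y < y_T`") — log-convexity propagates
the strict pair `ν_T(1) < ν_T(y_T)` to every `y < y_T`.
[cite: BeatonBousquetMelouDeGierDuminilCopinGuttmann2014, Corollary 8, proof (arXiv v5 p. 13: "ρ_T(y) > ρ_T(y_T) ⟺ y < y_T", from "the log-convexity of µ_T(y) in log y, together with ρ_T(1) > x_c")] -/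
theorem stripNu_lt_inv_of_lt_stripYT (hT : 1 ≤ T) {y : ℝ} (hy : 0 < y) (hlt : y < stripYT T) :
    stripNu T y < hexCriticalFugacity⁻¹ := by
  rw [← stripNu_stripYT hT]
  exact stripNu_lt_of_lt_right hT one_pos (one_lt_stripYT hT) (stripNu_one_lt_stripNu_stripYT hT) hy hlt

/-- ★★ **Above the threshold, STRICTLY: `y_T < y ⇒ x_c⁻¹ < ν_T(y)`** ("`ρ_T(y) < ρ_T(y_T) ⟸ y > y_T`").
[cite: BeatonBousquetMelouDeGierDuminilCopinGuttmann2014, Corollary 8, proof (arXiv v5 p. 13: "ρ_T(y) < ρ_T(y_T) ⟺ y > y_T")] -/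
theorem inv_lt_stripNu_of_stripYT_lt (hT : 1 ≤ T) {y : ℝ} (h : stripYT T < y) : hexCriticalFugacity⁻¹ < stripNu T y := by
  rw [← stripNu_stripYT hT]
  exact stripNu_lt_of_right_lt hT one_pos (one_lt_stripYT hT) (stripNu_one_lt_stripNu_stripYT hT) h

/-- **(15), first half: `ν_T(y) < x_c⁻¹ ↔ y < y_T`** (`y > 0`).
[cite: BeatonBousquetMelouDeGierDuminilCopinGuttmann2014, Corollary 8, proof (arXiv v5 p. 13, display (15): "ρ_T(y) > ρ_T(y_T) ⟺ y < y_T")] -/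
theorem stripNu_lt_inv_iff (hT : 1 ≤ T) {y : ℝ} (hy : 0 < y) : stripNu T y < hexCriticalFugacity⁻¹ ↔ y < stripYT T := by
  refine ⟨fun h => ?_, stripNu_lt_inv_of_lt_stripYT hT hy⟩
  by_contra hle
  rcases (not_lt.1 hle).eq_or_lt with heq | hlt
  · rw [← heq, stripNu_stripYT hT] at h
    exact lt_irrefl _ h
  · exact absurd h (not_lt.2 (inv_lt_stripNu_of_stripYT_lt hT hlt).le)

/-- **(15), second half: `x_c⁻¹ < ν_T(y) ↔ y_T < y`** (`y > 0`).
[cite: BeatonBousquetMelouDeGierDuminilCopinGuttmann2014, Corollary 8, proof (arXiv v5 p. 13, display (15): "ρ_T(y) < ρ_T(y_T) ⟺ y > y_T")] -/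
theorem inv_lt_stripNu_iff (hT : 1 ≤ T) {y : ℝ} (hy : 0 < y) : hexCriticalFugacity⁻¹ < stripNu T y ↔ stripYT T < y := by
  refine ⟨fun h => ?_, inv_lt_stripNu_of_stripYT_lt hT⟩
  by_contra hle
  rcases (not_lt.1 hle).eq_or_lt with heq | hlt
  · rw [heq, stripNu_stripYT hT] at h
    exact lt_irrefl _ h
  · exact absurd h (not_lt.2 (stripNu_lt_inv_of_lt_stripYT hT hy hlt).le)

/-- `ν_T(y) ≤ x_c⁻¹ ↔ y ≤ y_T` (`y > 0`). [cite: BeatonBousquetMelouDeGierDuminilCopinGuttmann2014, Corollary 8, proof (arXiv v5 p. 13, display (15))] -/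
theorem stripNu_le_inv_iff (hT : 1 ≤ T) {y : ℝ} (hy : 0 < y) : stripNu T y ≤ hexCriticalFugacity⁻¹ ↔ y ≤ stripYT T := by
  rw [← not_lt, inv_lt_stripNu_iff hT hy, not_lt]

/-- `x_c⁻¹ ≤ ν_T(y) ↔ y_T ≤ y` (`y > 0`). [cite: BeatonBousquetMelouDeGierDuminilCopinGuttmann2014, Corollary 8, proof (arXiv v5 p. 13, display (15))] -/
theorem inv_le_stripNu_iff (hT : 1 ≤ T) {y : ℝ} (hy : 0 < y) : hexCriticalFugacity⁻¹ ≤ stripNu T y ↔ stripYT T ≤ y := by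
  rw [← not_lt, stripNu_lt_inv_iff hT hy, not_lt]

/-! ### Uniqueness of `y_T` -/

/-- ★★ **`ν_T(y) = x_c⁻¹ ↔ y = y_T`** (`y > 0`): the lane's threshold is the UNIQUE positive solution of `ρ_T(y) = x_c`.
[cite: BeatonBousquetMelouDeGierDuminilCopinGuttmann2014, Corollary 8 (arXiv v5 p. 12: "There exists a unique y_T > 0 such that ρ_T(y_T) = x_c := 1/μ"; proof p. 13: "The uniqueness of y_T follows from the log-convexity of µ_T(y) in log y, together with ρ_T(1) > x_c")] -/
theorem stripNu_eq_inv_iff (hT : 1 ≤ T) {y : ℝ} (hy : 0 < y) : stripNu T y = hexCriticalFugacity⁻¹ ↔ y = stripYT T := by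
  refine ⟨fun h => ?_, fun h => h ▸ stripNu_stripYT hT⟩
  rcases lt_trichotomy y (stripYT T) with hlt | heq | hgt
  · exact absurd h (stripNu_lt_inv_of_lt_stripYT hT hy hlt).ne
  · exact heq
  · exact absurd h (inv_lt_stripNu_of_stripYT_lt hT hgt).ne'

/-- **"There exists a unique `y_T > 0` such that `ρ_T(y_T) = x_c`"** — for the lane's `ν_T = 1/ρ_T`; the solution is `HV.stripYT T`.
[cite: BeatonBousquetMelouDeGierDuminilCopinGuttmann2014, Corollary 8 (arXiv v5 p. 12, verbatim clause)] -/
theorem existsUnique_stripNu_eq_inv (hT : 1 ≤ T) : ∃! y : ℝ, 0 < y ∧ stripNu T y = hexCriticalFugacity⁻¹ :=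
  ⟨stripYT T, ⟨stripYT_pos hT, stripNu_stripYT hT⟩, fun _ hy => (stripNu_eq_inv_iff hT hy.1).1 hy.2⟩

/-- **`ν_T` is strictly increasing on `[y_T, ∞)`** (log-convexity and the strict pair `ν_T(1) < ν_T(y_T)`).
[cite: BeatonBousquetMelouDeGierDuminilCopinGuttmann2014, Proposition 6 (arXiv v5 p. 10: log-convex in log y) with Corollary 8, proof (p. 13)] -/
theorem strictMonoOn_stripNu_Ici_stripYT (hT : 1 ≤ T) : StrictMonoOn (stripNu T) (Set.Ici (stripYT T)) :=
  strictMonoOn_stripNu_Ici hT one_pos (one_lt_stripYT hT) (stripNu_one_lt_stripNu_stripYT hT)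

end Literature.Probability.RandomPlanarGeometry.SAW.HV
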